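import Mathlib
import HarnessLib
import HarnessLib.Audit
import Summits.Schanuel.Statement

/-!
Route: ToricSparse

CLOSED (retired) 2026-08-15T13:51:31Z by operator:999:1257524 — reason: not-a-thesis: assembly does not conclude the sub-problem Statement — note: D-0027 §2.1 audit (human 2026-08-15: routes that do not decide the summit are removed): the assembly concludes `ToricSchanuelTwo`, not the sub-problem statement; a NEW conforming route may be opened from the same idea (generated `closes : … → _root_.Schanuel`).. The file is kept as the record of this route; refuted decls are indexed as negative knowledge (`ledger negatives`).

# Route ToricSparse — toric Schanuel — binomial relation ideals of (x, eˣ) log-linearise; SC(2)'s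
toric sector is exactly a tower atom and a self-logarithmic monomial atom

SECTOR route (card Schanuel/Schanuel/toric-sparse-schanuel; like StokesConstantPi it targets a named
slice of the summit, not the summit).
For ℚ-linearly independent x ∈ ℂⁿ all 2n coordinates of p = (x, eˣ) are non-zero, so p ∈ 𝔾ₘ^{2n};
call x TORIC-BAD if p lies on an
algebraic translate g·T of a subtorus of dimension ≤ n − 1, i.e. if the saturated lattice Λ_x = {v ∈
ℤ^{2n} : p^v ∈ ℚ̄} has rank ≥ n + 1
(prime binomial ideals = torus-translate ideals, EisenbudSturmfels1996); a toric-bad x is a Schanuel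
counterexample whose relation
ideal is generated by binomials (e^e ∈ ℚ̄ ↔ x = (e, 1); eπ ∈ ℚ̄ ↔ x = (1, iπ); e^{π²} ∈ ℚ̄ ↔ x =
(iπ, π²); 2^{log 2} ∈ ℚ̄ ↔ x = (log 2, (log 2)²)).
It suffices to show X = ToricSchanuelTwo: no ℚ-linearly independent pair is toric-bad — among any
three ℤ-independent Laurent monomials in
(x₁, x₂, e^{x₁}, e^{x₂}) one is transcendental. The route's content is the EXACT reduction of X to
two atoms (ToricCensusTwo: X ↔ TowerAtom ∧
SelfLogMonomialAtom, provable now from Hermite–Lindemann) obtained by taking logarithms of ALL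
coordinates, and the atoms themselves.
Lean: `∀ (x : Fin 2 → ℂ), LinearIndependent ℚ x → ∀ v : Fin 3 → (Fin 2 ⊕ Fin 2 → ℤ),
LinearIndependent ℤ v → ∃ k, Transcendental ℚ (∏ i, Sum.elim x (Complex.exp ∘ x) i ^ (v k i))`

## Assembly
Pure logic (sorry-free in Sketch.lean, axioms propext/Classical.choice/Quot.sound: `fun hC hT hO =>
hC.mpr ⟨hT, hO⟩`): the census
equivalence turns the two atoms into the target. TwoLogMonomialAtom is a rung (the r = 0 face of Ω,
TwoLogIffPureSelfLog), not an assembly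
premise; SchanuelImpliesToric records that the whole route sits below `Schanuel` (a sector route: no
arrow to the summit is claimed).

Rationale: WHY THIS LINE. Grade Schanuel counterexamples by the number of monomials in their relations (a
parameter none of the 15 routes or the other cards uses) and
take the 2-monomial (toric) sector: with 𝓛 = {z : e^z ∈ ℚ̄} (a ℚ-subspace of ℂ containing 2πiℤ, so
branches never matter) the condition
p^v ∈ ℚ̄ reads a·Log x + b·x ∈ 𝓛, hence "x toric-bad" ⟺ dim_ℚ (ℚ⟨x, Log x⟩ + 𝓛)/𝓛 ≤ n − 1
(BiLogNormalForm) ⟺ x consists of n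
ℚ-independent algebraic Laurent monomials cᵢ w^{mᵢ} in some w ∈ (ℂˣ)^{n−1} all lying in ℚ⟨Log w⟩ + 𝓛
(MonomialNormalForm): Schanuel's
toric sector is Baker's problem for the module spanned by a point TOGETHER WITH ITS OWN LOGARITHM.
For n = 2 there is one w, and sorting the
exponents (m₁, m₂) ∈ ℤ² gives, using only Hermite–Lindemann (tree theorem
`Literature.NumberTheory.Transcendental.transcendental_exp_holds`):
m = (0,0) impossible; one mᵢ = 0 ⟺ TowerAtom fails (c·e^β − qβ ∈ 𝓛: "second-storey
Hermite–Lindemann", contains e^e, eπ, π/e ∉ ℚ̄);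
m₁m₂ ≠ 0 ⟺ SelfLogMonomialAtom fails (two independent algebraic monomials of one w in ℚ·Log w + 𝓛;
its pure-log face r = 0 is
TwoLogMonomialAtom ℓ₁^p ℓ₂^q ∉ ℚ̄, containing e^{π²} ∉ ℚ̄ and 2^{log 2} ∉ ℚ̄ of
Waldschmidt2005Periodes Ex. 26, with the face p + q = 0
KNOWN by Gelfond1934 / BakerTNT1975 Thm 2.1, tree `gelfond_schneider_holds`, `baker_holds`).
Imported: toric/binomial commutative algebra
(EisenbudSturmfels1996) for the dictionary, the unlikely-intersection grammar of Zilber2002 /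
KirbyZilber2014 / Pila2022 Def. 3.7
(where cosets of subtori live only on the multiplicative side — here the additive coordinates are
ALSO toric), linear forms in logarithms
(BakerTNT1975) as the engine that closes the known faces; every tree fact used (HL, LW, GS, Baker,
six exponentials) is PROVED, imports [].
What it does that prior routes do not: LogPatterns/RoyCriterion/AlgIndepMethod attack 𝓛 itself;
Zilber's special varieties L × hS keep L
ℚ-linear; CoprimeExpPolynomials grades by ℚ̄-rank, the linear-schanuel card by degree — toric
sparsity is orthogonal to all (binomials have
any degree and rank) and is the one sector where elimination is exact (Smith normal form), so its
census is a theorem, not a heuristic.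

RANKED CRUXES. #0 ToricSchanuelTwo (target) — TORIC SCHANUEL, n = 2: for ℚ-linearly independent x₁,
x₂, among any three ℤ-linearly independent Laurent monomials in (x₁, x₂, e^{x₁}, e^{x₂}) at least
one is transcendental (the point is on no algebraic translate of a subtorus of 𝔾ₘ⁴ of dimension ≤
1). (why it might fail: it contains e^e ∉ ℚ̄, eπ ∉ ℚ̄, e^{π²} ∉ ℚ̄, 2^{log 2} ∉ ℚ̄ — open since
Schneider/Lang; false iff one toric-bad pair exists (a binomial Schanuel counterexample), which
would refute SC itself.) [Lang1966, Pila2022, Waldschmidt2005Periodes, Rivoal2024,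
EisenbudSturmfels1996]
#2 SelfLogMonomialAtom (crux) — SELF-LOGARITHMIC MONOMIAL ATOM Ω (card atoms β, γ and the
"two-variable" branch δ, unified): for w ≠ 0, algebraic β₁, β₂ ≠ 0, non-zero integers m₁, m₂ and
rationals r₁, r₂ with β₁w^{m₁}, β₂w^{m₂} ℚ-linearly independent, NOT both βᵢw^{mᵢ} − rᵢ·Log w are
logarithms of algebraic numbers (equivalently e^{βᵢ w^{mᵢ}} ∈ ℚ̄·w^{rᵢ} cannot hold twice). Faces: r
= (0,0) = TwoLogMonomialAtom; one rᵢ = 0: Lambert/Ω-type e^{βwᵐ} ∈ ℚ̄·w^r for w a radical of a log;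
r₁r₂ ≠ 0, m₁ ≠ m₂: w a root of the trinomial β₁W^{m₁}/r₁ − β₂W^{m₂}/r₂ = ℓ ∈ 𝓛 with e^{β₁w^{m₁}/r₁}
∈ ℚ̄w. [difficulty: open-problem] (why it might fail: its r = 0 face is the 2-log case of algebraic
independence of logarithms (contains e^{π²}, 2^{log 2}, π·log 2 ∉ ℚ̄), beyond Baker and provably
beyond the linear-subgroup method (Roy1995 Thm 3.4); no tool sees Log w for transcendental w.)
[Waldschmidt2005Periodes, Waldschmidt2005, Roy1995, Pila2022, DaquinoFornasieroTerzo2017,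
MarquesSondow2010]
#3 TowerAtom (crux) — TOWER ATOM (second-storey Hermite–Lindemann; the exact toric form of card atom
α): for algebraic β ≠ 0, algebraic c ≠ 0 and rational q, c·e^β − qβ is not the logarithm of an
algebraic number, i.e. e^{c·e^β} ∉ ℚ̄·e^{qβ}. Instances: e^e ∉ ℚ̄ (β = c = 1, q = 0), e^e ∉ ℚ̄·e^ℚ,
eπ ∉ ℚ̄ and π/e ∉ ℚ̄ (β = ∓1, q = 0, iπ ∈ 𝓛), e ∉ ℚ + 𝓛. [difficulty: open-problem] (why it might
fail: contains the transcendence of e^e and of eπ (open, Rivoal2024 §4 p. 204; BakerTNT1975 Ch. 12);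
e^{c·e^z} is no E-function, so Siegel–Shidlovskii is blind and no auxiliary function adapted to both
storeys is known.) [Rivoal2024, BakerTNT1975, Lindemann1882, Lang1966, Waldschmidt2004]
#4 TwoLogMonomialAtom (crux) — TWO-LOG MONOMIAL ATOM (rung = pure-log face of Ω; Waldschmidt's Conj.
25 family / Pila2022 Conj. 13.5 for two logarithms, monomial case): for ℚ-linearly independent
logarithms of algebraic numbers ℓ₁, ℓ₂ and integers (p, q) ≠ (0, 0), ℓ₁^p·ℓ₂^q is transcendental.
Contains e^{π²} ∉ ℚ̄ ((iπ)²·(π²)⁻¹ = −1), 2^{log 2} ∉ ℚ̄, (log 2)(log 3) ∉ ℚ̄, π·log 2 ∉ ℚ̄; the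
face p + q = 0 is KNOWN (LogRatioKnown). [difficulty: open-problem] (why it might fail: "not even
two algebraically independent logarithms are known" (Roy1992 p. 22); quadratic relations on an
irreducible quadric are provably out of reach of the linear subgroup method (Roy1995 §3.2, tree
LinearSubgroupMethodLimit).) [Waldschmidt2005Periodes, Waldschmidt2005, Pila2022, Roy1995, Roy1992,
BakerTNT1975, Gelfond1934]
#5 ToricCensusTwo (crux) — TORIC CENSUS, n = 2 (card T2, sharpened to an equivalence):
ToricSchanuelTwo ↔ (TowerAtom ∧ SelfLogMonomialAtom). Proof plan (provable now):
MonomialNormalFormTwo, then sort (m₁, m₂): (0,0) contradicts Hermite–Lindemann (𝓛 ∩ ℚ̄ = {0});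
exactly one mᵢ = 0 rescales to a TowerAtom failure and back (w = e^β, monomials c·w and β); m₁m₂ ≠ 0
is verbatim Ω. Ranked 5 only because it names the atoms above; STAFF IT FIRST — it is the item that
says the sector has exactly these two atoms and no third. [deps: ToricSchanuelTwo, TowerAtom,
SelfLogMonomialAtom] [difficulty: M] (why it might fail: the hand census may have lost a
configuration in the WLOG rescalings (roots of unity, t ↦ t/d, saturation of Λ vs Λ⊗ℚ) — a surviving
third atom shape refutes the ↔ as stated (then restate with that atom added).)
[EisenbudSturmfels1996, Lindemann1882, BakerTNT1975, Zilber2002]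
#9 MonomialNormalFormTwo (support) — MONOMIAL NORMAL FORM, n = 2: ToricSchanuelTwo ⟺ for every w ≠
0, two ℚ-linearly independent algebraic Laurent monomials c₁w^{m₁}, c₂w^{m₂} (mᵢ ∈ ℤ, possibly 0)
never both lie in ℚ·Log w + 𝓛. (⇐: rank Λ_x ≥ 3 ⟹ x₁, x₂, Log x₁, Log x₂ ∈ ℚt + 𝓛 for one t; write
Log xᵢ = (mᵢ/d)t + μᵢ, w = e^{t/d}. ⇒: such monomials give x with Λ_x of rank ≥ 3.) Pure algebra: 𝓛
is a ℚ-subspace, x^a = e^{a Log x}. [difficulty: provable-now] [EisenbudSturmfels1996, BakerTNT1975]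
#9 MonomialNormalForm (support) — MONOMIAL NORMAL FORM, all n (level n = k + 1): toric Schanuel for
every n ⟺ for every w ∈ (ℂˣ)ᵏ, any k + 1 ℚ-linearly independent algebraic Laurent monomials
cᵢ·w^{mᵢ} do not all lie in ℚ·Log w₁ + … + ℚ·Log w_k + 𝓛 ("the algebraic monomials of w inside ℚ⟨Log
w⟩ + 𝓛 span ≤ k dimensions"; k = 0 is Hermite–Lindemann). [difficulty: provable-now]
[EisenbudSturmfels1996, Zilber2002]
#9 BiLogNormalForm (support) — BI-LOGARITHMIC DICTIONARY (card T1), all n: toric Schanuel for every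
n ⟺ for ℚ-linearly independent x ∈ ℂⁿ the 2n numbers xᵢ, Log xᵢ never all lie in span_ℚ(t₁, …, t_k)
+ 𝓛 with k < n (v ∈ Λ_x ⟺ a·Log x + b·x ∈ 𝓛, so rank Λ_x = 2n − dim_ℚ(ℚ⟨x, Log x⟩ + 𝓛)/𝓛).
[difficulty: provable-now] [Zilber2002, KirbyZilber2014, BakerTNT1975]
#9 SchanuelImpliesToric (support) — the sector lies below the summit: Schanuel ⟹ toric Schanuel for
every n (n + 1 independent algebraic monomial values put p = (x, eˣ) on a ℚ̄-variety of dimension ≤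
n − 1, so trdeg ℚ(x, eˣ) ≤ n − 1; uses `Algebra.trdeg` monotonicity and that each coordinate is
algebraic over n − 1 free monomials). [difficulty: L] [Lang1966, Pila2022]
#9 TwoLogIffPureSelfLog (support) — the two-log atom IS the pure-log face (r = 0) of Ω:
TwoLogMonomialAtom ⟺ for w ≠ 0 two ℚ-independent algebraic monomials β₁w^{m₁}, β₂w^{m₂} (mᵢ ≠ 0) are
not both in 𝓛. (⇒: ℓᵢ = βᵢw^{mᵢ} gives ℓ₁^{m₂}ℓ₂^{−m₁} ∈ ℚ̄. ⇐: for ℓ₁^pℓ₂^q = γ with p, q coprime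
and non-zero take m = (−q, p), w = ℓ₁^aℓ₂^b with bp − aq = 1; pq = 0 is Hermite–Lindemann.)
[difficulty: provable-now] [BakerTNT1975, Lindemann1882]
#9 LogRatioKnown (support) — the KNOWN face p + q = 0 of the two-log atom: for ℚ-independent ℓ₁, ℓ₂
∈ 𝓛 and p ≠ 0, (ℓ₁/ℓ₂)^p is transcendental (else ℓ₁ = bℓ₂ with b ∈ ℚ̄ ∖ ℚ and e^{bℓ₂} = e^{ℓ₁}
algebraic contradicts Gelfond–Schneider, tree
`Literature.NumberTheory.Transcendental.gelfond_schneider_holds`; or Baker, `baker_holds`).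
[difficulty: provable-now] [Gelfond1934, BakerTNT1975]

TWO-LAYER PLAN. Foreseen glued splits (k ≤ 3, depth 1), filed only when something lands: (i)
SelfLogMonomialAtom ⇐ PureLogFace (= TwoLogMonomialAtom via
TwoLogIffPureSelfLog) → LambertFace (one rᵢ = 0: e^{βwᵐ} ∉ ℚ̄·wʳ for w a radical of a non-zero
logarithm; the object of card
exp-log-diagonal-trajectory) → DoubleSelfLogFace (r₁r₂ ≠ 0) → SelfLogMonomialAtom; (ii) TowerAtom ⇐
TowerPure (q = 0: e^{c·e^β} ∉ ℚ̄, the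
e^e family) → TowerMixed (q ≠ 0) → TowerAtom, and above it the shared rung "1, λ, e^β are
ℚ̄-linearly independent (λ ∈ 𝓛 ∖ 0, β ∈ ℚ̄ˣ)"
to be filed ONCE together with card linear-schanuel-all-depths (it implies TowerAtom); (iii)
ToricCensusTwo ⇐ MonomialNormalFormTwo →
CaseSplit → ToricCensusTwo if a prover wants the normal form as a separate landing. Level n = 3
(four-exponentials-type configurations become
toric at n = 4: x = (x₁, x₂, x₁y, x₂y) carries X₁X₄ = X₂X₃) is a later expansion via
MonomialNormalForm, not filed now.

KILL CRITERIA. A toric-bad pair (¬ToricSchanuelTwo, e.g. a certified binomial relation for (e, 1) or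
(iπ, π²)) refutes Schanuel outright — every route
closes. ToricCensusTwo refuted by an explicit third configuration ⇒ `route edit --restate
ToricCensusTwo` adding that atom (the line
survives; the census claim was wrong). TowerAtom or SelfLogMonomialAtom refuted ⇒ ¬ToricSchanuelTwo
by the census ⇒ Schanuel refuted. If a
refuter finds the bi-logarithmic/monomial normal form already in print (Zilber–Kirby
exponential-closure literature, Waldschmidt GL326
Ch. 1 exercises), the supports become `known` and the route keeps only the atoms — then close
`superseded` in favour of filing TowerAtom /
TwoLogMonomialAtom as Literature open statements. AlgIndepLogarithms proved elsewhere moots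
TwoLogMonomialAtom and the r = 0 face only.

NOT DECOMPOSED YET. The three faces of Ω and the two of TowerAtom (Two-layer plan) — children,
later; quantitative versions (measures of simultaneous
approximation for (w, Log w) à la Waldschmidt2000 Ch. 15) that might close thin sub-faces of Ω (e.g.
m₁ = −m₂); the level-n census for n ≥ 3
(MonomialNormalForm gives the statement; the case tree over (m, r) ∈ ℤ^{(k+1)×k} × ℚ^{(k+1)×k}
modulo GL_k(ℤ) is a kit computation, card
T6, not an item); the functional face (bi-toric weak CIT from Ax, card T5) — true but not
load-bearing, and importing `ax_schanuel` would add
cone for nothing; Eisenbud–Sturmfels itself (we state toric-badness directly by monomials, so no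
binomial-ideal theory enters Lean).

CHEAPEST FALSIFIER. (1) A grounder re-derives the n = 2 census from MonomialNormalFormTwo in an
hour: the only delicate branch is m₁m₂r₁r₂ ≠ 0 with m₁ ≠ m₂
(it must land inside Ω as stated — it does, verbatim, because Ω quantifies over all r ∈ ℚ²); any
configuration escaping Tower ∧ Ω kills
ToricCensusTwo as stated. (2) Lookup: is "dim_ℚ(ℚ⟨x, Log x⟩ + 𝓛)/𝓛" or an equivalent bi-logarithmic
normal form in Zilber2002 /
KirbyZilber2014 / Waldschmidt2000? (searched this session: Pila2022 Def. 3.7 and Ch. 13 put cosets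
of subtori on the multiplicative side
only; full-text `lit search` was unavailable (rc 75), so a refuter should run `lit search --hybrid
"logarithm of a transcendental number
together with the number linear forms Schanuel"`). (3) PSLQ at 60 digits on the four flagship
instances (e^e, eπ, e^{π²}, 2^{log 2}) against
ℚ̄-multiples of small height — a negative result is expected and cheap; a positive one refutes
Schanuel.

NUMBERS. Items at open: 12 (1 target, 4 cruxes, 6 support, 1 assembly). Known: Toric-SC(1) =
Hermite–Lindemann (k = 0 of MonomialNormalForm);
the face p + q = 0 of TwoLogMonomialAtom (Gelfond–Schneider 1934 / Baker 1966); Baker: ℚ̄ˣ + ℚ̄·𝓛 is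
disjoint from 𝓛. Open flagship
instances inside the target: e^e, eπ, π/e (TowerAtom); e^{π²}, 2^{log 2}, π·log 2, (log 2)(log 3) ∉
ℚ̄ (TwoLogMonomialAtom). Tree facts
used, all PROVED: transcendental_exp_holds, algebraicIndependent_exp_holds, gelfond_schneider_holds,
baker_holds, six_exponentials_holds.

DEFINITION REQUESTS. None. 𝓛 is written pointwise as `IsAlgebraic ℚ (Complex.exp l)` (as in tree
`baker`, `AlgIndepLogarithms`); toric-badness is written by
monomials `∏ i, Sum.elim x (Complex.exp ∘ x) i ^ (v k i)` with `v : Fin (n+1) → (Fin n ⊕ Fin n → ℤ)`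
ℤ-linearly independent, so neither
binomial ideals nor subtori need a Lean notion. No cite facts wanted (HL, LW, GS, Baker, six
exponentials are tree theorems).

Novelty: Searches (2026-08-15): `lit frontier Schanuel --since 2020` (30 rows; nearest:
doi:10.1112/jlms.70536 "Exploring Zilber's conjecture on
atypical intersections in tori", arXiv:2504.10611 — CIT/Zilber–Pink in tori, multiplicative side
only); `lit bridges Schanuel --cross any`
(30, none toric-on-the-additive-side); `lit galaxy search "Schanuel's conjecture" --star all` (40
rows: Pila 2022, Murty–Rath 2014,
D'Aquino–Macintyre–Terzo Schanuel Nullstellensatz, DaquinoFornasieroTerzo2017 =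
doi:10.1090/tran/7206 generic solutions of iterated-exponential
equations under SC — the SC-side theory of one-variable systems like Ω/Tower, never the toric
census); `lit galaxy search "consequences of
Schanuel's conjecture" --star all` (4); `lit vsearch` ×2 (bi-toric phrasing → Pila2022 pp. 23, 93–95
read: Def. 3.7 weakly special =
translates of rational linear subspaces with images cosets of subtori, Conj. 13.1, Thm 13.4, Conj.
13.5; e^e phrasing → Chudnovsky1984,
Angell2022, NesterenkoPhilippon2001); `lit search` / `lit search --hybrid` UNAVAILABLE all session
(searchd rc 75, 3 attempts) — flagged in
Cheapest falsifier (2) for the refuter. Card audit (refuter-triage 2026-08-15): Eisenbud–Sturmfels +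
coordinatewise Log not in print or pool.
Nearest prior art found: Zilber2002 (doi:10.1112/s0024610701002861) and KirbyZilber2014 (special
varieties L × hS, L ℚ-linear: additive
side never toric); Pila2022 Def. 3.7 / Ch. 13 (cosets of subtori = images of weakly specials);
EisenbudSturmfels1996
(Eisen  [refs: 10.1112/jlms.70536, 10.1090/tran/7206, 10.1112/s0024610701002861, 2504.10611, doi:10.1112/jlms.70536, doi:10.1090/tran/7206, doi:10.1112/s0024610701002861, DaquinoFornasieroTerzo2017, Pila2022, Chudnovsky1984, NesterenkoPhilippon2001, Zilber2002, KirbyZilber2014, EisenbudSturmfels1996, Roy1995]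

Barriers (technique_class: toric-intersections linear-forms-in-logarithms census): - technique_class: toric-intersections linear-forms-in-logarithms census
- Literature.Barriers.Schanuel.AlgebraicIndependenceOfLogarithms: APPLIES to TwoLogMonomialAtom and
to the r = 0 face of SelfLogMonomialAtom (2-log algebraic independence is beyond every
linear-independence method); not evaded — the route ISOLATES this face as an atom and proves
everything around it with Hermite–Lindemann/Baker, which lie inside the barrier's proved (linear)
region; the bet for the atom itself is external (holonomy / E⊗G engines of other cards), named, not
supplied.
- Literature.Barriers.Schanuel.LinearSubgroupMethodLimit: APPLIES to the quadratic instances ℓ₁² ∈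
ℚ̄·ℓ₂ (e^{π²}, 2^{log 2}) of TwoLogMonomialAtom — Roy's no-go says the linear subgroup method cannot
reach points on an irreducible quadric; it does not evade it; the bet is only that monomial
(rank-one, "fewnomial") relations are the most structured quadratic relations, the one region where
partial results exist at all (Waldschmidt2005 Thm 2.11, Cor. 2.12–2.14), and the atom is filed as a
target for other engines, not claimed.
- Literature.Barriers.Schanuel.EFunctionValuesAtAlgebraicPoints: APPLIES to TowerAtom (e^{c·e^β} is
not the value of an E-function at an algebraic point, cf. tree ExpExpNotEValue); Siegel–Shidlovskii
alone cannot prove it; not evaded — TowerAtom is filed as the clean target for mixed E/log engines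
(cards tensor-mixed-gevrey-division, shift-difference-periods).
- Literature.Barriers.Schanuel.AxSchanuelFunc

History (route lifecycle, newest last):
- 2026-08-15T13:51:32Z · CLOSED retired — not-a-thesis: assembly does not conclude the sub-problem Statement (operator:999:1257524)

sub-problem: Schanuel · status: closed(retired) · opened planner-plancard-Schanuel-Schanuel-toric-spar-fd09ac9e-0 2026-08-15T12:08:09Z · rev 0 · ledger route-Schanuel-ToricSparse
GENERATED by the gate from the ledger (D-0016/17). Provers cite these decls: `theorem foo : Summit.Schanuel.Schanuel.Theses.ToricSparse.<Decl> := …` in Summits/Schanuel/Schanuel/Theorems/<Name>.lean.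
-/

namespace Summit.Schanuel.Schanuel.Theses.ToricSparse

open scoped BigOperators Topology Manifold Classical MeasureTheory ProbabilityTheory Matrix InnerProductSpace ComplexConjugate ContinuousMap
open Filter Set Function TopologicalSpace MeasureTheory

attribute [summit_statement] _root_.Schanuel

open Literature.Periods

/-- item stmt-Schanuel-7317 · target · rank 0 · closed · moot by None · by planner
why it might fail: it contains e^e ∉ ℚ̄, eπ ∉ ℚ̄, e^{π²} ∉ ℚ̄, 2^{log 2} ∉ ℚ̄ — open since Schneider/Lang; false iff one toric-bad pair exists (a binomial Schanuel counterexample), which would refute SC itself.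
sources: Lang1966, Pila2022, Waldschmidt2005Periodes, Rivoal2024, EisenbudSturmfels1996
[target] TORIC SCHANUEL, n = 2: for ℚ-linearly independent x₁, x₂, among any three ℤ-linearly
independent Laurent monomials in (x₁, x₂, e^{x₁}, e^{x₂}) at least one is transcendental (the point
is on no algebraic translate of a subtorus of 𝔾ₘ⁴ of dimension ≤ 1). -/
@[route_item "route-Schanuel-ToricSparse"]
def ToricSchanuelTwo : Prop :=
  ∀ (x : Fin 2 → ℂ), LinearIndependent ℚ x → ∀ v : Fin 3 → (Fin 2 ⊕ Fin 2 → ℤ), LinearIndependent ℤ v → ∃ k, Transcendental ℚ (∏ i, Sum.elim x (Complex.exp ∘ x) i ^ (v k i))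

/-- item stmt-Schanuel-7318 · crux · rank 2 · closed · moot by None · by planner
why it might fail: its r = 0 face is the 2-log case of algebraic independence of logarithms (contains e^{π²}, 2^{log 2}, π·log 2 ∉ ℚ̄), beyond Baker and provably beyond the linear-subgroup method (Roy1995 Thm 3.4); no tool sees Log w for transcendental w.
sources: Waldschmidt2005Periodes, Waldschmidt2005, Roy1995, Pila2022, DaquinoFornasieroTerzo2017, MarquesSondow2010
[crux] SELF-LOGARITHMIC MONOMIAL ATOM Ω (card atoms β, γ and the "two-variable" branch δ, unified):
for w ≠ 0, algebraic β₁, β₂ ≠ 0, non-zero integers m₁, m₂ and rationals r₁, r₂ with β₁w^{m₁},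
β₂w^{m₂} ℚ-linearly independent, NOT both βᵢw^{mᵢ} − rᵢ·Log w are logarithms of algebraic numbers
(equivalently e^{βᵢ w^{mᵢ}} ∈ ℚ̄·w^{rᵢ} cannot hold twice). Faces: r = (0,0) = TwoLogMonomialAtom;
one rᵢ = 0: Lambert/Ω-type e^{βwᵐ} ∈ ℚ̄·w^r for w a radical of a log; r₁r₂ ≠ 0, m₁ ≠ m₂: w a root of
the trinomial β₁W^{m₁}/r₁ − β₂W^{m₂}/r₂ = ℓ ∈ 𝓛 with e^{β₁w^{m₁}/r₁} ∈ ℚ̄w. [difficulty: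
open-problem] -/
@[route_item "route-Schanuel-ToricSparse"]
def SelfLogMonomialAtom : Prop :=
  ∀ (w : ℂ) (β : Fin 2 → ℂ) (m : Fin 2 → ℤ) (r : Fin 2 → ℚ), w ≠ 0 → (∀ i, IsAlgebraic ℚ (β i) ∧ β i ≠ 0 ∧ m i ≠ 0) → LinearIndependent ℚ (fun i => β i * w ^ (m i)) → ∃ i, ¬ IsAlgebraic ℚ (Complex.exp (β i * w ^ (m i) - (r i : ℂ) * Complex.log w))

/-- item stmt-Schanuel-7319 · crux · rank 3 · closed · moot by None · by planner
why it might fail: contains the transcendence of e^e and of eπ (open, Rivoal2024 §4 p. 204; BakerTNT1975 Ch. 12); e^{c·e^z} is no E-function, so Siegel–Shidlovskii is blind and no auxiliary function adapted to both storeys is known.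
sources: Rivoal2024, BakerTNT1975, Lindemann1882, Lang1966, Waldschmidt2004
[crux] TOWER ATOM (second-storey Hermite–Lindemann; the exact toric form of card atom α): for
algebraic β ≠ 0, algebraic c ≠ 0 and rational q, c·e^β − qβ is not the logarithm of an algebraic
number, i.e. e^{c·e^β} ∉ ℚ̄·e^{qβ}. Instances: e^e ∉ ℚ̄ (β = c = 1, q = 0), e^e ∉ ℚ̄·e^ℚ, eπ ∉ ℚ̄
and π/e ∉ ℚ̄ (β = ∓1, q = 0, iπ ∈ 𝓛), e ∉ ℚ + 𝓛. [difficulty: open-problem] -/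
@[route_item "route-Schanuel-ToricSparse"]
def TowerAtom : Prop :=
  ∀ (β c : ℂ) (q : ℚ), IsAlgebraic ℚ β → β ≠ 0 → IsAlgebraic ℚ c → c ≠ 0 → ¬ IsAlgebraic ℚ (Complex.exp (c * Complex.exp β - (q : ℂ) * β))

/-- item stmt-Schanuel-7320 · crux · rank 4 · closed · moot by None · by planner
why it might fail: "not even two algebraically independent logarithms are known" (Roy1992 p. 22); quadratic relations on an irreducible quadric are provably out of reach of the linear subgroup method (Roy1995 §3.2, tree LinearSubgroupMethodLimit).
sources: Waldschmidt2005Periodes, Waldschmidt2005, Pila2022, Roy1995, Roy1992, BakerTNT1975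
[crux] TWO-LOG MONOMIAL ATOM (rung = pure-log face of Ω; Waldschmidt's Conj. 25 family / Pila2022
Conj. 13.5 for two logarithms, monomial case): for ℚ-linearly independent logarithms of algebraic
numbers ℓ₁, ℓ₂ and integers (p, q) ≠ (0, 0), ℓ₁^p·ℓ₂^q is transcendental. Contains e^{π²} ∉ ℚ̄
((iπ)²·(π²)⁻¹ = −1), 2^{log 2} ∉ ℚ̄, (log 2)(log 3) ∉ ℚ̄, π·log 2 ∉ ℚ̄; the face p + q = 0 is KNOWN
(LogRatioKnown). [difficulty: open-problem] -/
@[route_item "route-Schanuel-ToricSparse"]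
def TwoLogMonomialAtom : Prop :=
  ∀ (l₁ l₂ : ℂ) (p q : ℤ), IsAlgebraic ℚ (Complex.exp l₁) → IsAlgebraic ℚ (Complex.exp l₂) → LinearIndependent ℚ ![l₁, l₂] → ¬ (p = 0 ∧ q = 0) → Transcendental ℚ (l₁ ^ p * l₂ ^ q)

/-- item stmt-Schanuel-7321 · crux · rank 5 · closed · moot by None · by planner
why it might fail: the hand census may have lost a configuration in the WLOG rescalings (roots of unity, t ↦ t/d, saturation of Λ vs Λ⊗ℚ) — a surviving third atom shape refutes the ↔ as stated (then restate with that atom added).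
sources: EisenbudSturmfels1996, Lindemann1882, BakerTNT1975, Zilber2002
[crux] TORIC CENSUS, n = 2 (card T2, sharpened to an equivalence): ToricSchanuelTwo ↔ (TowerAtom ∧
SelfLogMonomialAtom). Proof plan (provable now): MonomialNormalFormTwo, then sort (m₁, m₂): (0,0)
contradicts Hermite–Lindemann (𝓛 ∩ ℚ̄ = {0}); exactly one mᵢ = 0 rescales to a TowerAtom failure and
back (w = e^β, monomials c·w and β); m₁m₂ ≠ 0 is verbatim Ω. Ranked 5 only because it names the
atoms above; STAFF IT FIRST — it is the item that says the sector has exactly these two atoms and no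
third. [deps: ToricSchanuelTwo, TowerAtom, SelfLogMonomialAtom] [difficulty: M] -/
@[route_item "route-Schanuel-ToricSparse"]
def ToricCensusTwo : Prop :=
  ToricSchanuelTwo ↔ (TowerAtom ∧ SelfLogMonomialAtom)

/-- item stmt-Schanuel-7322 · support · rank 9 · closed · moot by None · by planner
sources: EisenbudSturmfels1996, BakerTNT1975
[support] MONOMIAL NORMAL FORM, n = 2: ToricSchanuelTwo ⟺ for every w ≠ 0, two ℚ-linearly
independent algebraic Laurent monomials c₁w^{m₁}, c₂w^{m₂} (mᵢ ∈ ℤ, possibly 0) never both lie in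
ℚ·Log w + 𝓛. (⇐: rank Λ_x ≥ 3 ⟹ x₁, x₂, Log x₁, Log x₂ ∈ ℚt + 𝓛 for one t; write Log xᵢ = (mᵢ/d)t +
μᵢ, w = e^{t/d}. ⇒: such monomials give x with Λ_x of rank ≥ 3.) Pure algebra: 𝓛 is a ℚ-subspace,
x^a = e^{a Log x}. [difficulty: provable-now] -/
@[route_item "route-Schanuel-ToricSparse"]
def MonomialNormalFormTwo : Prop :=
  ToricSchanuelTwo ↔ ∀ (w : ℂ) (c : Fin 2 → ℂ) (m : Fin 2 → ℤ) (r : Fin 2 → ℚ), w ≠ 0 → (∀ i, IsAlgebraic ℚ (c i) ∧ c i ≠ 0) → LinearIndependent ℚ (fun i => c i * w ^ (m i)) → ∃ i, ¬ IsAlgebraic ℚ (Complex.exp (c i * w ^ (m i) - (r i : ℂ) * Complex.log w))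

/-- item stmt-Schanuel-7323 · support · rank 9 · closed · moot by None · by planner
sources: EisenbudSturmfels1996, Zilber2002
[support] MONOMIAL NORMAL FORM, all n (level n = k + 1): toric Schanuel for every n ⟺ for every w ∈
(ℂˣ)ᵏ, any k + 1 ℚ-linearly independent algebraic Laurent monomials cᵢ·w^{mᵢ} do not all lie in
ℚ·Log w₁ + … + ℚ·Log w_k + 𝓛 ("the algebraic monomials of w inside ℚ⟨Log w⟩ + 𝓛 span ≤ k
dimensions"; k = 0 is Hermite–Lindemann). [difficulty: provable-now] -/
@[route_item "route-Schanuel-ToricSparse"]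
def MonomialNormalForm : Prop :=
  (∀ (n : ℕ) (x : Fin n → ℂ), LinearIndependent ℚ x → ∀ v : Fin (n + 1) → (Fin n ⊕ Fin n → ℤ), LinearIndependent ℤ v → ∃ k, Transcendental ℚ (∏ i, Sum.elim x (Complex.exp ∘ x) i ^ (v k i))) ↔ ∀ (k : ℕ) (w : Fin k → ℂ) (c : Fin (k + 1) → ℂ) (m : Fin (k + 1) → Fin k → ℤ) (r : Fin (k + 1) → Fin k → ℚ), (∀ j, w j ≠ 0) → (∀ i, IsAlgebraic ℚ (c i) ∧ c i ≠ 0) → LinearIndependent ℚ (fun i => c i * ∏ j, w j ^ (m i j)) → ∃ i, ¬ IsAlgebraic ℚ (Complex.exp (c i * ∏ j, w j ^ (m i j) - ∑ j, (r i j : ℂ) * Complex.log (w j)))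

/-- item stmt-Schanuel-7324 · support · rank 9 · closed · moot by None · by planner
sources: Zilber2002, KirbyZilber2014, BakerTNT1975
[support] BI-LOGARITHMIC DICTIONARY (card T1), all n: toric Schanuel for every n ⟺ for ℚ-linearly
independent x ∈ ℂⁿ the 2n numbers xᵢ, Log xᵢ never all lie in span_ℚ(t₁, …, t_k) + 𝓛 with k < n (v ∈
Λ_x ⟺ a·Log x + b·x ∈ 𝓛, so rank Λ_x = 2n − dim_ℚ(ℚ⟨x, Log x⟩ + 𝓛)/𝓛). [difficulty: provable-now] -/
@[route_item "route-Schanuel-ToricSparse"]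
def BiLogNormalForm : Prop :=
  (∀ (n : ℕ) (x : Fin n → ℂ), LinearIndependent ℚ x → ∀ v : Fin (n + 1) → (Fin n ⊕ Fin n → ℤ), LinearIndependent ℤ v → ∃ k, Transcendental ℚ (∏ i, Sum.elim x (Complex.exp ∘ x) i ^ (v k i))) ↔ ∀ (n k : ℕ) (x : Fin n → ℂ) (t : Fin k → ℂ), k < n → LinearIndependent ℚ x → ¬ ∀ i, (∃ l, IsAlgebraic ℚ (Complex.exp l) ∧ x i - l ∈ Submodule.span ℚ (Set.range t)) ∧ (∃ l, IsAlgebraic ℚ (Complex.exp l) ∧ Complex.log (x i) - l ∈ Submodule.span ℚ (Set.range t))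

/-- item stmt-Schanuel-7325 · support · rank 9 · closed · moot by None · by planner
sources: Lang1966, Pila2022
[support] the sector lies below the summit: Schanuel ⟹ toric Schanuel for every n (n + 1 independent
algebraic monomial values put p = (x, eˣ) on a ℚ̄-variety of dimension ≤ n − 1, so trdeg ℚ(x, eˣ) ≤
n − 1; uses `Algebra.trdeg` monotonicity and that each coordinate is algebraic over n − 1 free
monomials). [difficulty: L] -/
@[route_item "route-Schanuel-ToricSparse"]
def SchanuelImpliesToric : Prop :=
  Schanuel → ∀ (n : ℕ) (x : Fin n → ℂ), LinearIndependent ℚ x → ∀ v : Fin (n + 1) → (Fin n ⊕ Fin n → ℤ), LinearIndependent ℤ v → ∃ k, Transcendental ℚ (∏ i, Sum.elim x (Complex.exp ∘ x) i ^ (v k i))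

/-- item stmt-Schanuel-7326 · support · rank 9 · closed · moot by None · by planner
sources: BakerTNT1975, Lindemann1882
[support] the two-log atom IS the pure-log face (r = 0) of Ω: TwoLogMonomialAtom ⟺ for w ≠ 0 two
ℚ-independent algebraic monomials β₁w^{m₁}, β₂w^{m₂} (mᵢ ≠ 0) are not both in 𝓛. (⇒: ℓᵢ = βᵢw^{mᵢ}
gives ℓ₁^{m₂}ℓ₂^{−m₁} ∈ ℚ̄. ⇐: for ℓ₁^pℓ₂^q = γ with p, q coprime and non-zero take m = (−q, p), w =
ℓ₁^aℓ₂^b with bp − aq = 1; pq = 0 is Hermite–Lindemann.) [difficulty: provable-now] -/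
@[route_item "route-Schanuel-ToricSparse"]
def TwoLogIffPureSelfLog : Prop :=
  TwoLogMonomialAtom ↔ ∀ (w : ℂ) (β : Fin 2 → ℂ) (m : Fin 2 → ℤ), w ≠ 0 → (∀ i, IsAlgebraic ℚ (β i) ∧ β i ≠ 0 ∧ m i ≠ 0) → LinearIndependent ℚ (fun i => β i * w ^ (m i)) → ∃ i, ¬ IsAlgebraic ℚ (Complex.exp (β i * w ^ (m i)))

/-- item stmt-Schanuel-7327 · support · rank 9 · closed · moot by None · by planner
sources: Gelfond1934, BakerTNT1975
[support] the KNOWN face p + q = 0 of the two-log atom: for ℚ-independent ℓ₁, ℓ₂ ∈ 𝓛 and p ≠ 0,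
(ℓ₁/ℓ₂)^p is transcendental (else ℓ₁ = bℓ₂ with b ∈ ℚ̄ ∖ ℚ and e^{bℓ₂} = e^{ℓ₁} algebraic
contradicts Gelfond–Schneider, tree
`Literature.NumberTheory.Transcendental.gelfond_schneider_holds`; or Baker, `baker_holds`).
[difficulty: provable-now] -/
@[route_item "route-Schanuel-ToricSparse"]
def LogRatioKnown : Prop :=
  ∀ (l₁ l₂ : ℂ) (p : ℤ), IsAlgebraic ℚ (Complex.exp l₁) → IsAlgebraic ℚ (Complex.exp l₂) → LinearIndependent ℚ ![l₁, l₂] → p ≠ 0 → Transcendental ℚ (l₁ ^ p * l₂ ^ (-p))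

/-- item stmt-Schanuel-7328 · assembly · rank 1 · closed · moot by None · by planner
sources: Lang1966, EisenbudSturmfels1996
[assembly] ToricCensusTwo → TowerAtom → SelfLogMonomialAtom → ToricSchanuelTwo. -/
@[route_item "route-Schanuel-ToricSparse"]
def Assembly : Prop :=
  ToricCensusTwo → TowerAtom → SelfLogMonomialAtom → ToricSchanuelTwo

end Summit.Schanuel.Schanuel.Theses.ToricSparse
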